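import Summits.QuantumAdvantage.QuantumAdvantage.Theorems.CubicForrelationNearExactIsExactCubicFormCells
import Summits.QuantumAdvantage.QuantumAdvantage.Theorems.CubicForrelationNearExactIsExactCubicFormCellsOne
import Summits.QuantumAdvantage.QuantumAdvantage.Theorems.CubicForrelationNearExactIsExactCubicFormThirdZero

/-!
# Crux `CubicForrelation.NearExactIsExact` (stmt-QuantumAdvantage-14043) — MIXED third differences of an adapted-frame function in terms of
  the forms of the cells' halves (the `G`/`Γ` dictionary)

Certificate seat `b2b-cforr-cert` (gen 41).  HONEST FRAMING: kernel-checked bookkeeping (standard axioms), step (c) of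
HOME/b2b-cforr-cert-g41/ASSEMBLY-BLUEPRINT-W8.md.  On `3 + (1 + n)` bits (`y ∈ 𝔽₂³`, `s₀`, `s' ∈ 𝔽₂ⁿ`): the third difference of `κ` along
`e_t` (`t < 3`, a `y`-direction), `e_{3+1+σ}`, `e_{3+1+τ}` at the base point `(v, 0)` is the xor of the second differences at `0`, along
`e_σ, e_τ`, of the `0`-halves of the two cells `ρ_{v ⊕ e_t}` and `ρ_v` — i.e. the tensor slices `G = ι_{y₁}d`, `Γ = ι_{y₂}d` of the R2 leaves
(…TwelvePartnerR2Leaf*) restricted to `H × H` are differences of the halves' forms controlled by cell lemma L2 (…CubicFormCellL2).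
Nothing about `θ₁₂`; NOT summit progress.

* `tcm_mixed_third`: the identity above.

References: folklore.  Axioms: the standard three.
-/

set_option linter.dupNamespace false -- D-0017: single-problem summit ⇒ `QuantumAdvantage.QuantumAdvantage` by design

namespace Summit.QuantumAdvantage.QuantumAdvantage.Theorems.CubicForrelation.NearExactIsExact

open Finset
open Literature.Computability.QuantumComplexity.BuzetChailloux (bxor zeroVec bxor_comm bxor_self bxor_zeroVec zeroVec_bxor
  bxor_bxor_cancel_left)

variable {n : ℕ}

/-- **Mixed third differences are differences of the halves' forms.**  See the module docstring. [folklore] -/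
theorem tcm_mixed_third (κ : (Fin (3 + (1 + n)) → Bool) → Bool) (v : Fin 3 → Bool) (t : Fin 3) (σ τ : Fin n) :
    let e3 : Fin 3 → (Fin (3 + (1 + n)) → Bool) := fun t l => decide (l = Fin.castAdd (1 + n) t)
    let eS : Fin n → (Fin (3 + (1 + n)) → Bool) := fun σ l => decide (l = Fin.natAdd 3 (Fin.natAdd 1 σ))
    let half : (Fin 3 → Bool) → (Fin n → Bool) → Bool := fun w s => κ (Fin.append w (Fin.append ![false] s))
    let B : (Fin 3 → Bool) → Bool := fun w =>
      (half w zeroVec ^^ half w (bxor zeroVec (fun l => decide (l = τ)))) ^^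
        (half w (bxor zeroVec (fun l => decide (l = σ))) ^^ half w (bxor (bxor zeroVec (fun l => decide (l = σ))) (fun l => decide (l = τ))))
    let x : Fin (3 + (1 + n)) → Bool := Fin.append v zeroVec
    (((κ x ^^ κ (bxor x (eS τ))) ^^ (κ (bxor x (eS σ)) ^^ κ (bxor (bxor x (eS σ)) (eS τ)))) ^^
        ((κ (bxor x (e3 t)) ^^ κ (bxor (bxor x (e3 t)) (eS τ))) ^^
          (κ (bxor (bxor x (e3 t)) (eS σ)) ^^ κ (bxor (bxor (bxor x (e3 t)) (eS σ)) (eS τ))))) =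
      (B (bxor v (fun l => decide (l = t))) ^^ B v) := by
  intro e3 eS half B x
  -- unit vectors as appended vectors
  have he3 : ∀ t', e3 t' = Fin.append (fun l : Fin 3 => decide (l = t')) (zeroVec : Fin (1 + n) → Bool) := fun t' => tcc_unit_left t'
  have heS : ∀ σ', eS σ' = Fin.append (zeroVec : Fin 3 → Bool) (Fin.append (zeroVec : Fin 1 → Bool) (fun l : Fin n => decide (l = σ'))) := by
    intro σ'
    show (fun l : Fin (3 + (1 + n)) => decide (l = Fin.natAdd 3 (Fin.natAdd 1 σ'))) = _
    rw [tcc_unit_right (Fin.natAdd 1 σ'), tco_unit_right σ']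
  have h0 : (zeroVec : Fin (1 + n) → Bool) = Fin.append (zeroVec : Fin 1 → Bool) (zeroVec : Fin n → Bool) := by
    funext l; refine Fin.addCases (fun i => ?_) (fun j => ?_) l <;> simp [zeroVec]
  have h1 : (zeroVec : Fin 1 → Bool) = ![false] := by funext i; fin_cases i; rfl
  have hb : bxor ![false] ![false] = (![false] : Fin 1 → Bool) := by funext i; fin_cases i; rfl
  simp only [x, he3, heS, h0, tcc_append_bxor, tcz_append_bxor, bxor_zeroVec, zeroVec_bxor, h1, hb, B, half]
  -- both sides are the same eight values
  generalize κ (Fin.append v (Fin.append ![false] zeroVec)) = a₁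
  generalize κ (Fin.append v (Fin.append ![false] (fun l => decide (l = τ)))) = a₂
  generalize κ (Fin.append v (Fin.append ![false] (fun l => decide (l = σ)))) = a₃
  generalize κ (Fin.append v (Fin.append ![false] (bxor (fun l => decide (l = σ)) (fun l => decide (l = τ))))) = a₄
  generalize κ (Fin.append (bxor v (fun l => decide (l = t))) (Fin.append ![false] zeroVec)) = a₅
  generalize κ (Fin.append (bxor v (fun l => decide (l = t))) (Fin.append ![false] (fun l => decide (l = τ)))) = a₆
  generalize κ (Fin.append (bxor v (fun l => decide (l = t))) (Fin.append ![false] (fun l => decide (l = σ)))) = a₇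
  generalize κ (Fin.append (bxor v (fun l => decide (l = t))) (Fin.append ![false] (bxor (fun l => decide (l = σ)) (fun l => decide (l = τ))))) = a₈
  revert a₁ a₂ a₃ a₄ a₅ a₆ a₇ a₈
  decide

end Summit.QuantumAdvantage.QuantumAdvantage.Theorems.CubicForrelation.NearExactIsExact
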